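import Mathlib
import Summits.Ventures.HodgeRepro.CMType
import Summits.Ventures.HodgeRepro.HodgeSets
import Summits.Ventures.HodgeRepro.CMRank
import Summits.Ventures.HodgeRepro.MuTable
import Summits.Ventures.HodgeRepro.MuPairs
import Summits.Ventures.HodgeRepro.MuPairsRank

/-!
# The pairs theorem for powers `A_Φ^k` (blind cell `pub-hodge-repro`, seat p2)

On a power `A_Φ^k` the basis classes are indexed by subsets `Δ` of `Fin k × G` (factor, embedding), and
Pohlmann's criterion reads `|{(i,s) ∈ Δ : s ∈ gΦ}| = |Δ|/2` for all `g`.  More generally we index the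
characters by any finite type `X` with a map `π : X → G` (the embedding used), the weight of `x` being
`w_{π x}`.  The argument of `MuPairsRank.lean` is insensitive to the indexing: under
`cmRank Φ = #(antipodal classes) + 1`, every Hodge set `Δ ⊆ X` is a disjoint union of antipodal pairs
`{x, y}` (`w_{π x} + w_{π y} = 1`).  For `X = Fin k × G` a pair may straddle two factors; it is still a
`(1,1)`-class on `A_Φ^k` (Lefschetz `(1,1)`), so all Hodge classes on every power are products of divisor
classes — the regime of Hazama's theorem (Gordon §6.4) extended to induced types.
-/

set_option autoImplicit false

open Finset
open scoped Pointwise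

namespace HodgeRepro

variable {G : Type*} [Group G] [DecidableEq G] [Fintype G]
variable {X : Type*} [DecidableEq X] [Fintype X]

/-- Pohlmann's criterion on `X`-indexed exponent sets: `|{x ∈ Δ : π x ∈ gΦ}| = |Δ|/2` for all `g`. -/
def IsHodgeX (Φ : Finset G) (π : X → G) (Δ : Finset X) : Prop :=
  ∀ g : G, 2 * (Δ.filter fun x => π x ∈ g • Φ).card = Δ.card

/-- Antipodal indices: weights adding up to the all-ones vector. -/
def IsAntipodalX (Φ : Finset G) (π : X → G) (x y : X) : Prop := weight Φ (π x) + weight Φ (π y) = 1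

omit [Fintype G] [DecidableEq X] [Fintype X] in
/-- Antipodal indices are distinct (their weights differ at `g = 1`). -/
theorem IsAntipodalX.ne {Φ : Finset G} {π : X → G} {x y : X} (h : IsAntipodalX Φ π x y) : x ≠ y := by
  rintro rfl
  have h1 := congrFun h 1
  simp only [Pi.add_apply, Pi.one_apply, weight_apply] at h1
  split_ifs at h1 <;> norm_num at h1

omit [Fintype G] [DecidableEq X] [Fintype X] in
/-- The weight sum of `Δ` at `g` counts the indices with `π x ∈ gΦ`. -/
theorem sum_weight_X (Φ : Finset G) (π : X → G) (Δ : Finset X) (g : G) :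
    ∑ x ∈ Δ, weight Φ (π x) g = ((Δ.filter fun x => π x ∈ g • Φ).card : ℚ) := by
  rw [card_filter]
  push_cast
  rfl

omit [Fintype G] [DecidableEq X] [Fintype X] in
/-- Pohlmann's criterion on `X` in weight form. -/
theorem isHodgeX_iff_sum_weight (Φ : Finset G) (π : X → G) (Δ : Finset X) (p : ℕ) (hΔ : Δ.card = 2 * p) :
    IsHodgeX Φ π Δ ↔ ∑ x ∈ Δ, weight Φ (π x) = fun _ => (p : ℚ) := by
  unfold IsHodgeX
  rw [hΔ]
  constructor
  · intro h
    ext g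
    rw [Finset.sum_apply, sum_weight_X]
    have := h g
    exact_mod_cast (by omega : (Δ.filter fun x => π x ∈ g • Φ).card = p)
  · intro h g
    have := congrFun h g
    rw [Finset.sum_apply, sum_weight_X] at this
    have : (Δ.filter fun x => π x ∈ g • Φ).card = p := by exact_mod_cast this
    omega

omit [Fintype G] [Fintype X] in
/-- Removing an antipodal pair from a Hodge set leaves a Hodge set. -/
theorem IsHodgeX.sdiff_pair {Φ : Finset G} {π : X → G} {Δ : Finset X} (hΔ : IsHodgeX Φ π Δ)
    {x y : X} (hx : x ∈ Δ) (hy : y ∈ Δ) (h : IsAntipodalX Φ π x y) : IsHodgeX Φ π (Δ \ {x, y}) := by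
  have hsub : {x, y} ⊆ Δ := by
    intro z hz
    simp only [mem_insert, mem_singleton] at hz
    rcases hz with rfl | rfl <;> assumption
  have heven : Even Δ.card := ⟨(Δ.filter fun z => π z ∈ (1 : G) • Φ).card, by have := hΔ 1; omega⟩
  obtain ⟨p, hp⟩ := heven
  have hcard : Δ.card = 2 * p := by omega
  have hp1 : 1 ≤ p := by
    have := card_le_card hsub
    rw [card_pair h.ne] at this
    omega
  have hsum := (isHodgeX_iff_sum_weight Φ π Δ p hcard).1 hΔ
  have hcard' : (Δ \ {x, y}).card = 2 * (p - 1) := by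
    rw [card_sdiff_of_subset hsub, card_pair h.ne, hcard]
    omega
  rw [isHodgeX_iff_sum_weight Φ π _ (p - 1) hcard']
  have hsplit := sum_sdiff (f := fun z => weight Φ (π z)) hsub
  rw [hsum, sum_pair h.ne] at hsplit
  ext g
  have h1 := congrFun hsplit g
  have h2 := congrFun h g
  simp only [Finset.sum_apply, Pi.add_apply, Pi.one_apply] at h1 h2 ⊢
  have hp' : ((p - 1 : ℕ) : ℚ) = (p : ℚ) - 1 := by
    rw [Nat.cast_sub hp1, Nat.cast_one]
  rw [hp']
  linarith

/-- `Δ ⊆ X` is a disjoint union of antipodal pairs. -/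
inductive IsPairUnionX (Φ : Finset G) (π : X → G) : Finset X → Prop
  | empty : IsPairUnionX Φ π ∅
  | insert_pair {Δ : Finset X} {x y : X} : IsAntipodalX Φ π x y → x ∉ Δ → y ∉ Δ → IsPairUnionX Φ π Δ →
      IsPairUnionX Φ π (insert x (insert y Δ))

omit [Fintype G] [Fintype X] in
/-- Descent: if every nonempty Hodge set contains an antipodal pair, every Hodge set is a pair union. -/
theorem isPairUnionX_of_forall_exists {Φ : Finset G} {π : X → G}
    (H : ∀ Δ : Finset X, IsHodgeX Φ π Δ → Δ.Nonempty → ∃ x ∈ Δ, ∃ y ∈ Δ, IsAntipodalX Φ π x y) :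
    ∀ Δ : Finset X, IsHodgeX Φ π Δ → IsPairUnionX Φ π Δ := by
  intro Δ
  induction Δ using Finset.strongInduction with
  | H Δ ih =>
    intro hΔ
    rcases Δ.eq_empty_or_nonempty with rfl | hne
    · exact IsPairUnionX.empty
    · obtain ⟨x, hx, y, hy, hxy⟩ := H Δ hΔ hne
      have hlt : Δ \ {x, y} ⊂ Δ := by
        rw [Finset.ssubset_iff_subset_ne]
        refine ⟨sdiff_subset, ?_⟩
        intro heq
        have : x ∈ Δ \ {x, y} := by rw [heq]; exact hx
        simp at this
      have hrest := ih _ hlt (hΔ.sdiff_pair hx hy hxy)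
      have hΔeq : Δ = insert x (insert y (Δ \ {x, y})) := by
        ext z
        simp only [mem_insert, mem_sdiff, mem_singleton]
        constructor
        · intro hz
          by_cases h1 : z = x
          · exact Or.inl h1
          · by_cases h2 : z = y
            · exact Or.inr (Or.inl h2)
            · exact Or.inr (Or.inr ⟨hz, by tauto⟩)
        · rintro (rfl | rfl | ⟨hz, _⟩) <;> assumption
      rw [hΔeq]
      exact IsPairUnionX.insert_pair hxy (by simp) (by simp) hrest

omit [Fintype X] in
/-- In a Hodge set `Δ ⊆ X`, each antipodal class is balanced (under the rank hypothesis). -/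
theorem card_filter_weight_eq_card_filter_antipode_X {c : G} {Φ : Finset G} (hc : IsComplexConj c)
    (hΦ : IsCMType c Φ) (hrank : cmRank Φ = (antiReps Φ).card + 1) {π : X → G} {Δ : Finset X}
    (hΔ : IsHodgeX Φ π Δ) {r : G} (hr : r ∈ antiReps Φ) :
    (Δ.filter fun x => weight Φ (π x) = weight Φ r).card =
      (Δ.filter fun x => weight Φ (π x) = 1 - weight Φ r).card := by
  have heven : Even Δ.card := ⟨(Δ.filter fun z => π z ∈ (1 : G) • Φ).card, by have := hΔ 1; omega⟩
  obtain ⟨p, hp⟩ := heven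
  have hcard : Δ.card = 2 * p := by omega
  have hsum := (isHodgeX_iff_sum_weight Φ π Δ p hcard).1 hΔ
  set a : G → ℕ := fun r => (Δ.filter fun x => weight Φ (π x) = weight Φ r).card with ha
  set b : G → ℕ := fun r => (Δ.filter fun x => weight Φ (π x) = 1 - weight Φ r).card with hb
  -- fibre decomposition along `antiRep Φ ∘ π`
  have hfil : ∀ r ∈ antiReps Φ, Δ.filter (fun x => antiRep Φ (π x) = r) =
      Δ.filter (fun x => weight Φ (π x) = weight Φ r) ∪
        Δ.filter (fun x => weight Φ (π x) = 1 - weight Φ r) := by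
    intro r hr
    ext x
    simp only [mem_filter, mem_union]
    constructor
    · rintro ⟨hx, h⟩
      have := (antiRep_eq_antiRep_iff Φ (π x) r).1 (by rw [h, antiRep_eq_self_of_mem hr])
      rcases this with h' | h'
      · exact Or.inl ⟨hx, h'⟩
      · exact Or.inr ⟨hx, h'⟩
    · rintro (⟨hx, h⟩ | ⟨hx, h⟩)
      · refine ⟨hx, ?_⟩
        rw [← antiRep_eq_self_of_mem hr, antiRep_eq_antiRep_iff]
        exact Or.inl h
      · refine ⟨hx, ?_⟩
        rw [← antiRep_eq_self_of_mem hr, antiRep_eq_antiRep_iff]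
        exact Or.inr h
  have hdisj : ∀ r : G, Disjoint (Δ.filter fun x => weight Φ (π x) = weight Φ r)
      (Δ.filter fun x => weight Φ (π x) = 1 - weight Φ r) := by
    intro r
    rw [disjoint_filter]
    intro x _ h1 h2
    rw [h1] at h2
    exact weight_ne_one_sub_weight Φ r h2
  have hfib : ∑ x ∈ Δ, weight Φ (π x) =
      ∑ r ∈ antiReps Φ, ((a r : ℚ) • weight Φ r + (b r : ℚ) • (1 - weight Φ r)) := by
    rw [← sum_fiberwise_of_maps_to (g := fun x => antiRep Φ (π x)) (t := antiReps Φ)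
      (fun x _ => antiRep_mem_antiReps Φ (π x))]
    refine sum_congr rfl fun r hr => ?_
    rw [hfil r hr, sum_union (hdisj r)]
    congr 1
    · rw [sum_congr rfl (fun x hx => (mem_filter.1 hx).2), sum_const, ← Nat.cast_smul_eq_nsmul ℚ]
    · rw [sum_congr rfl (fun x hx => (mem_filter.1 hx).2), sum_const, ← Nat.cast_smul_eq_nsmul ℚ]
  set g : Option (antiReps Φ) → ℚ := fun o => o.elim ((∑ r ∈ antiReps Φ, (b r : ℚ)) - p)
    (fun r => (a r : ℚ) - b r) with hg
  have hrel : ∑ o, g o • antiFam Φ o = 0 := by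
    rw [Fintype.sum_option]
    have h1 : ∑ r : antiReps Φ, g (some r) • antiFam Φ (some r) =
        ∑ r ∈ antiReps Φ, ((a r : ℚ) - b r) • weight Φ r := by
      rw [← sum_coe_sort (antiReps Φ)]
      rfl
    rw [h1]
    have h2 : ∑ r ∈ antiReps Φ, ((a r : ℚ) - b r) • weight Φ r =
        ∑ r ∈ antiReps Φ, ((a r : ℚ) • weight Φ r + (b r : ℚ) • (1 - weight Φ r)) -
          (∑ r ∈ antiReps Φ, (b r : ℚ)) • (1 : G → ℚ) := by
      rw [sum_smul, ← sum_sub_distrib]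
      refine sum_congr rfl fun r _ => ?_
      simp only [sub_smul, smul_sub]
      abel
    rw [h2, ← hfib, hsum]
    show ((∑ r ∈ antiReps Φ, (b r : ℚ)) - p) • (1 : G → ℚ) +
      ((fun _ => (p : ℚ)) - (∑ r ∈ antiReps Φ, (b r : ℚ)) • (1 : G → ℚ)) = 0
    ext z
    simp only [Pi.add_apply, Pi.sub_apply, Pi.smul_apply, Pi.one_apply, smul_eq_mul, Pi.zero_apply]
    ring
  have hli := Fintype.linearIndependent_iff.1 (linearIndependent_antiFam hc hΦ hrank) g hrel
  have := hli (some ⟨r, hr⟩)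
  simp only [hg, Option.elim] at this
  have : (a r : ℚ) = b r := by linarith
  exact_mod_cast this

omit [Fintype X] in
/-- Under the rank hypothesis every nonempty Hodge set `Δ ⊆ X` contains an antipodal pair. -/
theorem exists_antipodalX_of_isHodgeX {c : G} {Φ : Finset G} (hc : IsComplexConj c) (hΦ : IsCMType c Φ)
    (hrank : cmRank Φ = (antiReps Φ).card + 1) {π : X → G} {Δ : Finset X} (hΔ : IsHodgeX Φ π Δ)
    (hne : Δ.Nonempty) : ∃ x ∈ Δ, ∃ y ∈ Δ, IsAntipodalX Φ π x y := by
  obtain ⟨x, hx⟩ := hne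
  set r := antiRep Φ (π x) with hr
  have hrR : r ∈ antiReps Φ := antiRep_mem_antiReps Φ (π x)
  have hbal := card_filter_weight_eq_card_filter_antipode_X hc hΦ hrank hΔ hrR
  rcases antiRep_equiv Φ (π x) with h | h
  · have hpos : 0 < (Δ.filter fun z => weight Φ (π z) = weight Φ r).card :=
      card_pos.2 ⟨x, mem_filter.2 ⟨hx, h.symm⟩⟩
    rw [hbal] at hpos
    obtain ⟨y, hy⟩ := card_pos.1 hpos
    rw [mem_filter] at hy
    refine ⟨x, hx, y, hy.1, ?_⟩
    unfold IsAntipodalX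
    rw [hy.2, ← h]; abel
  · have hpos : 0 < (Δ.filter fun z => weight Φ (π z) = 1 - weight Φ r).card :=
      card_pos.2 ⟨x, mem_filter.2 ⟨hx, by rw [h]; abel⟩⟩
    rw [← hbal] at hpos
    obtain ⟨y, hy⟩ := card_pos.1 hpos
    rw [mem_filter] at hy
    refine ⟨x, hx, y, hy.1, ?_⟩
    unfold IsAntipodalX
    rw [hy.2, h]; abel

omit [Fintype X] in
/-- **Pairs theorem on `X`-indexed exponent sets** (powers and products of `A_Φ`). -/
theorem isPairUnionX_of_isHodgeX {c : G} {Φ : Finset G} (hc : IsComplexConj c) (hΦ : IsCMType c Φ)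
    (hrank : cmRank Φ = (antiReps Φ).card + 1) {π : X → G} {Δ : Finset X} (hΔ : IsHodgeX Φ π Δ) :
    IsPairUnionX Φ π Δ :=
  isPairUnionX_of_forall_exists (fun _ hΔ' hne => exists_antipodalX_of_isHodgeX hc hΦ hrank hΔ' hne) Δ hΔ

/-! ### Powers `A_Φ^k`: exponent vectors as subsets of `Fin k × G` -/

/-- The exponent set of an exponent vector `Δ : Fin k → Finset G` on a power `A_Φ^k`. -/
def expSet {k : ℕ} (Δ : Fin k → Finset G) : Finset (Fin k × G) :=
  univ.biUnion fun i => (Δ i).map ⟨fun s => (i, s), fun _ _ h => (Prod.mk.inj h).2⟩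

omit [Group G] [Fintype G] in
/-- Membership in the exponent set: `(i, s) ∈ expSet Δ ↔ s ∈ Δ i`. -/
theorem mem_expSet {k : ℕ} (Δ : Fin k → Finset G) (i : Fin k) (s : G) :
    (i, s) ∈ expSet Δ ↔ s ∈ Δ i := by
  simp [expSet]

omit [Group G] [Fintype G] in
/-- The exponent set has `Σ_i |Δ_i|` elements. -/
theorem card_expSet {k : ℕ} (Δ : Fin k → Finset G) : (expSet Δ).card = ∑ i, (Δ i).card := by
  unfold expSet
  rw [card_biUnion]
  · exact sum_congr rfl fun i _ => card_map _
  · intro i _ j _ hij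
    rw [Function.onFun, disjoint_left]
    intro x hx hx'
    rw [mem_map] at hx hx'
    obtain ⟨s, _, rfl⟩ := hx
    obtain ⟨t, _, h⟩ := hx'
    exact hij (Prod.mk.inj h).1.symm

omit [Fintype G] in
/-- Pohlmann's criterion for the power `A_Φ^k` (`IsHodgeFam` with all types equal to `Φ`) is the
`X`-indexed criterion on the exponent set. -/
theorem isHodgeFam_pow_iff {k : ℕ} (Φ : Finset G) (Δ : Fin k → Finset G) :
    (∀ g : G, 2 * ∑ i, muVal Φ (Δ i) g = ∑ i, (Δ i).card) ↔ IsHodgeX Φ Prod.snd (expSet Δ) := by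
  unfold IsHodgeX
  rw [card_expSet]
  refine forall_congr' fun g => ?_
  have : ((expSet Δ).filter fun x : Fin k × G => x.2 ∈ g • Φ).card = ∑ i, muVal Φ (Δ i) g := by
    unfold expSet
    rw [filter_biUnion, card_biUnion]
    · refine sum_congr rfl fun i _ => ?_
      rw [filter_map, card_map]
      rfl
    · intro i _ j _ hij
      rw [Function.onFun, disjoint_left]
      intro x hx hx'
      rw [mem_filter, mem_map] at hx hx'
      obtain ⟨⟨s, _, rfl⟩, _⟩ := hx
      obtain ⟨⟨t, _, h⟩, _⟩ := hx'
      exact hij (Prod.mk.inj h).1.symm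
  rw [this]

/-- **Pairs theorem for powers.**  Under the rank hypothesis, every Hodge class of `A_Φ^k` (exponent
vector `Δ`) is a disjoint union of antipodal pairs, possibly straddling two factors. -/
theorem isPairUnionX_pow {c : G} {Φ : Finset G} (hc : IsComplexConj c) (hΦ : IsCMType c Φ)
    (hrank : cmRank Φ = (antiReps Φ).card + 1) {k : ℕ} {Δ : Fin k → Finset G}
    (hΔ : ∀ g : G, 2 * ∑ i, muVal Φ (Δ i) g = ∑ i, (Δ i).card) :
    IsPairUnionX Φ Prod.snd (expSet Δ) :=
  isPairUnionX_of_isHodgeX hc hΦ hrank ((isHodgeFam_pow_iff Φ Δ).1 hΔ)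

end HodgeRepro
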